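import Summits.Ventures.DiscreteObjects.UnitDistance.RhombusChain13
import HarnessLib

/-!
# A 10-vertex 4-chromatic unit-distance graph over the quartic field `ℚ(√3, √(5 − 2√3)) ⊂ ℚ₁₁` (cell `pub-namedobj`, target (U), seat udg g24)

Framing (verbatim for the cell): lottery ticket; floor = certified bounds/negative ranges.

`RhombusChain13.lean` isolated the mechanism of SMALL 4-chromatic unit-distance graphs in Moser-free fields: a closed chain of `k` unit rhombi,
i.e. unit vectors `u₁, …, u_k` with `|u₁ + ⋯ + u_k|² = 1/3`.  `k = 2` is the Moser spindle (`√11`, impossible inside `ℚ₁₁`); over `ℚ(√3,√5)` the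
shortest chains have `k = 4` (13 vertices).  For `k = 3`, normalising `u₁ = 1`, a chain exists over a field `K ∋ √3` iff some unit vector `(c, s) ∈ K²`
has `32 − 8√3·c − 12c² ∈ K^{×2}` (seat analysis, THEORY-U24 §3); `c = 1` gives `4(5 − 2√3)`, so the QUARTIC field `K₄ = ℚ(√3, ρ)`, `ρ = √(5 − 2√3)`,
carries a closed 3-chain: the 10-VERTEX, 16-EDGE graph `R₁₀` of this file (all coordinates have denominator `12`; the closing unit vector is
`e^{iπ/6} = (√3/2, 1/2)`).  `K₄ ⊂ ℚ₁₁` (`√3 ↦ 6 (mod 11)` makes `5 − 2√3 ≡ 4 = 2²`), and `K₄(√5)` is the relative quadratic 'L-world' `L_{d*}`,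
`d* = (3−√3)/2`, `4d*−1 = 5−2√3`, of THEORY-U23 §7 (udg g23) — which is thereby the admissible world with the smallest known 4-chromatic pieces
(10 vertices, Golomb-sized; Moser's field has 7).

DATA.  `r10pts`: the points `((a + b√3 + cρ + d√3ρ)/12, (e + f√3 + gρ + h√3ρ)/12)`.  With `α = a + b√3`, `β = c + d√3` one has
`(α + βρ)² = α² + β²(5 − 2√3) + 2αβρ`, whence the integer unit test `unitStepK4` on the basis `1, √3, ρ, √3ρ` (`k4Norm0/3/ρ/3ρ`).
The rhombi are `{0,1,2,3}`, `{3,4,5,6}`, `{6,7,8,9}` (base, two obtuse vertices, tip); the closing edge is `0 ~ 9`.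

THEOREMS.  `not_colorable_three_r10Graph` (three diamonds + one edge, via `diamond_tip_eq`), `colorable_four_r10Graph`, `chromaticNumber_r10Graph`
(`χ(R₁₀) = 4`, `16` edges), the exact realisation `dist_ptK4_eq_one` (`ρ² = 5 − 2√3` by `Real.sq_sqrt`), the homomorphism into `Γ(K²)` for every real
field `K ∋ √3, ρ` and `not_colorable_three_plane_of_sqrt3_rho_mem`: `χ(K²) ≥ 4` for every such `K` — the first non-multiquadratic row of the cell's
field-plane table (`χ(ℚ(√3)²) = 3` is in the tree; the upper bound `χ(K₄²) ≤ 5` holds by the 11-adic embedding but is NOT formalised here).  The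
witness, the `k = 3` criterion and the row: ours (seat analysis), not found in print — PROVISIONAL.  Its geometric fractional chromatic number is
`10/3` (MRVZ LP, exact; FAMILIES-U24 #14).
-/

namespace Summit.Ventures.DiscreteObjects.UnitDistance

open SimpleGraph

/-- Integer coordinate table of `R₁₀`: entry `((a,b,c,d),(e,f,g,h))` is `((a + b√3 + cρ + d√3ρ)/12, (e + f√3 + gρ + h√3ρ)/12)`, `ρ = √(5 − 2√3)`. -/
def r10pts : List ((ℤ × ℤ × ℤ × ℤ) × (ℤ × ℤ × ℤ × ℤ)) :=
  [((0, 0, 0, 0), (0, 0, 0, 0)),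
   ((12, 0, 0, 0), (0, 0, 0, 0)),
   ((6, 0, 0, 0), (0, 6, 0, 0)),
   ((18, 0, 0, 0), (0, 6, 0, 0)),
   ((12, 2, 0, 0), (0, 6, -6, -2)),
   ((15, 1, 3, 3), (3, 3, -3, -1)),
   ((9, 3, 3, 3), (3, 3, -9, -3)),
   ((3, 5, 3, 3), (3, 3, -3, -1)),
   ((6, 4, 0, 0), (6, 0, -6, -2)),
   ((0, 6, 0, 0), (6, 0, 0, 0))]

/-- Coordinates of vertex `v` of `R₁₀` (junk `0` beyond `10`). -/
def r10c (v : ℕ) : (ℤ × ℤ × ℤ × ℤ) × (ℤ × ℤ × ℤ × ℤ) := r10pts.getD v ((0, 0, 0, 0), (0, 0, 0, 0))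

/-- The `1`-part of `(a + b√3 + cρ + d√3ρ)²` (`ρ² = 5 − 2√3`): `a² + 3b² + 5c² + 15d² − 12cd`. -/
def k4Norm0 (x : ℤ × ℤ × ℤ × ℤ) : ℤ := x.1 ^ 2 + 3 * x.2.1 ^ 2 + 5 * x.2.2.1 ^ 2 + 15 * x.2.2.2 ^ 2 - 12 * x.2.2.1 * x.2.2.2
/-- The `√3`-part: `2ab + 10cd − 2c² − 6d²`. -/
def k4Norm3 (x : ℤ × ℤ × ℤ × ℤ) : ℤ := 2 * x.1 * x.2.1 + 10 * x.2.2.1 * x.2.2.2 - 2 * x.2.2.1 ^ 2 - 6 * x.2.2.2 ^ 2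
/-- The `ρ`-part: `2ac + 6bd`. -/
def k4NormR (x : ℤ × ℤ × ℤ × ℤ) : ℤ := 2 * x.1 * x.2.2.1 + 6 * x.2.1 * x.2.2.2
/-- The `√3ρ`-part: `2ad + 2bc`. -/
def k4Norm3R (x : ℤ × ℤ × ℤ × ℤ) : ℤ := 2 * x.1 * x.2.2.2 + 2 * x.2.1 * x.2.2.1

/-- Exact unit-distance test on the integer data (basis `1, √3, ρ, √3ρ`, denominator `12`): `(Δx)² + (Δy)² = 1` iff the coefficients are `(144,0,0,0)`. -/
def unitStepK4 (p q : (ℤ × ℤ × ℤ × ℤ) × (ℤ × ℤ × ℤ × ℤ)) : Bool :=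
  (k4Norm0 (bqSub q.1 p.1) + k4Norm0 (bqSub q.2 p.2) == 144) && (k4Norm3 (bqSub q.1 p.1) + k4Norm3 (bqSub q.2 p.2) == 0) &&
    (k4NormR (bqSub q.1 p.1) + k4NormR (bqSub q.2 p.2) == 0) && (k4Norm3R (bqSub q.1 p.1) + k4Norm3R (bqSub q.2 p.2) == 0)

/-- Negating a difference leaves `k4Norm0` unchanged. -/
theorem k4Norm0_sub_comm (x y : ℤ × ℤ × ℤ × ℤ) : k4Norm0 (bqSub x y) = k4Norm0 (bqSub y x) := by
  simp only [k4Norm0, bqSub]; ring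
/-- Negating a difference leaves `k4Norm3` unchanged. -/
theorem k4Norm3_sub_comm (x y : ℤ × ℤ × ℤ × ℤ) : k4Norm3 (bqSub x y) = k4Norm3 (bqSub y x) := by
  simp only [k4Norm3, bqSub]; ring
/-- Negating a difference leaves `k4NormR` unchanged. -/
theorem k4NormR_sub_comm (x y : ℤ × ℤ × ℤ × ℤ) : k4NormR (bqSub x y) = k4NormR (bqSub y x) := by
  simp only [k4NormR, bqSub]; ring
/-- Negating a difference leaves `k4Norm3R` unchanged. -/
theorem k4Norm3R_sub_comm (x y : ℤ × ℤ × ℤ × ℤ) : k4Norm3R (bqSub x y) = k4Norm3R (bqSub y x) := by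
  simp only [k4Norm3R, bqSub]; ring

/-- The integer unit test never holds between a point and itself. -/
theorem unitStepK4_self (p : (ℤ × ℤ × ℤ × ℤ) × (ℤ × ℤ × ℤ × ℤ)) : unitStepK4 p p = false := by
  simp [unitStepK4, k4Norm0, bqSub]

/-- The integer unit test is symmetric. -/
theorem unitStepK4_comm (p q : (ℤ × ℤ × ℤ × ℤ) × (ℤ × ℤ × ℤ × ℤ)) : unitStepK4 p q = unitStepK4 q p := by
  simp only [unitStepK4, k4Norm0_sub_comm q.1 p.1, k4Norm0_sub_comm q.2 p.2, k4Norm3_sub_comm q.1 p.1, k4Norm3_sub_comm q.2 p.2,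
    k4NormR_sub_comm q.1 p.1, k4NormR_sub_comm q.2 p.2, k4Norm3R_sub_comm q.1 p.1, k4Norm3R_sub_comm q.2 p.2]

/-- THE WITNESS GRAPH `R₁₀` on `Fin 10`. -/
def r10Graph : SimpleGraph (Fin 10) where
  Adj v w := unitStepK4 (r10c v) (r10c w) = true
  symm := ⟨fun v w h => by rw [unitStepK4_comm]; exact h⟩
  loopless := ⟨fun v h => by rw [unitStepK4_self] at h; exact Bool.false_ne_true h⟩

/-- Adjacency of `R₁₀` is decidable. -/
instance : DecidableRel r10Graph.Adj := fun v w => inferInstanceAs (Decidable (unitStepK4 (r10c v) (r10c w) = true))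

/-- KERNEL FACT: the 16 edges (rhombi `{0,1,2,3}`, `{3,4,5,6}`, `{6,7,8,9}`, closing edge `0 ~ 9`). -/
theorem r10_edges :
    r10Graph.Adj 0 1 ∧ r10Graph.Adj 0 2 ∧ r10Graph.Adj 1 2 ∧ r10Graph.Adj 3 1 ∧ r10Graph.Adj 3 2 ∧
    r10Graph.Adj 3 4 ∧ r10Graph.Adj 3 5 ∧ r10Graph.Adj 4 5 ∧ r10Graph.Adj 6 4 ∧ r10Graph.Adj 6 5 ∧
    r10Graph.Adj 6 7 ∧ r10Graph.Adj 6 8 ∧ r10Graph.Adj 7 8 ∧ r10Graph.Adj 9 7 ∧ r10Graph.Adj 9 8 ∧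
    r10Graph.Adj 0 9 := by
  unfold r10Graph; decide

/-- `R₁₀` IS NOT 3-COLOURABLE: the three rhombi force vertices `3, 6, 9` to carry the colour of `0`, and `0 ~ 9`. -/
theorem not_colorable_three_r10Graph : ¬ r10Graph.Colorable 3 := by
  rintro ⟨C⟩
  obtain ⟨h01, h02, h12, h31, h32, h34, h35, h45, h64, h65, h67, h68, h78, h97, h98, h09⟩ := r10_edges
  have e3 : C 3 = C 0 := diamond_tip_eq C h01 h02 h12 h31 h32
  have e6 : C 6 = C 3 := diamond_tip_eq C h34 h35 h45 h64 h65
  have e9 : C 9 = C 6 := diamond_tip_eq C h67 h68 h78 h97 h98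
  exact C.valid h09 (by rw [e9, e6, e3])

/-- An explicit proper 4-colouring of `R₁₀`. -/
def r10col4 : List (Fin 4) := [0, 1, 2, 0, 1, 2, 0, 1, 2, 3]

/-- `R₁₀` is 4-colourable. -/
theorem colorable_four_r10Graph : r10Graph.Colorable 4 := by
  refine ⟨Coloring.mk (fun v => r10col4.getD v.val 0) ?_⟩
  intro v w hvw
  have key : ∀ v w : Fin 10, unitStepK4 (r10c v) (r10c w) = true → r10col4.getD v.val 0 ≠ r10col4.getD w.val 0 := by
    decide
  exact key v w hvw

/-- `χ(R₁₀) = 4`. -/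
theorem chromaticNumber_r10Graph : r10Graph.chromaticNumber = 4 := by
  apply le_antisymm colorable_four_r10Graph.chromaticNumber_le
  by_contra hlt
  have hlt' : r10Graph.chromaticNumber < (3 : ℕ∞) + 1 := lt_of_not_ge hlt
  have hle : r10Graph.chromaticNumber ≤ (3 : ℕ) := Order.le_of_lt_add_one hlt'
  exact not_colorable_three_r10Graph (chromaticNumber_le_iff_colorable.mp hle)

/-- KERNEL FACT: `R₁₀` has exactly `16` edges (`32` ordered adjacent pairs). -/
theorem r10_card_edges : ((Finset.univ : Finset (Fin 10 × Fin 10)).filter fun p => r10Graph.Adj p.1 p.2).card = 32 := by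
  unfold r10Graph; decide

end Summit.Ventures.DiscreteObjects.UnitDistance

noncomputable section

namespace Summit.Ventures.DiscreteObjects.UnitDistance

open SimpleGraph IntermediateField
open scoped IntermediateField

/-! ## Realisation over `ℚ(√3, ρ)`, `ρ = √(5 − 2√3)` -/

/-- `ρ = √(5 − 2√3)`. -/
def rhoK4 : ℝ := Real.sqrt (5 - 2 * Real.sqrt 3)

/-- `5 − 2√3 ≥ 0`. -/
theorem five_sub_two_sqrt3_nonneg : (0 : ℝ) ≤ 5 - 2 * Real.sqrt 3 := by
  have h3 : Real.sqrt 3 ^ 2 = 3 := Real.sq_sqrt (by norm_num)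
  have h0 : 0 ≤ Real.sqrt 3 := Real.sqrt_nonneg 3
  nlinarith

/-- `ρ² = 5 − 2√3`. -/
theorem rhoK4_sq : rhoK4 ^ 2 = 5 - 2 * Real.sqrt 3 := by
  unfold rhoK4; exact Real.sq_sqrt five_sub_two_sqrt3_nonneg

/-- The real number `(a + b√3 + cρ + d√3ρ)/12` with integer data `(a,b,c,d)`. -/
def k4Val (x : ℤ × ℤ × ℤ × ℤ) : ℝ :=
  ((x.1 : ℝ) + (x.2.1 : ℝ) * Real.sqrt 3 + (x.2.2.1 : ℝ) * rhoK4 + (x.2.2.2 : ℝ) * (Real.sqrt 3 * rhoK4)) / 12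

/-- The plane point with integer data `((a,b,c,d),(e,f,g,h))`. -/
def ptK4 (p : (ℤ × ℤ × ℤ × ℤ) × (ℤ × ℤ × ℤ × ℤ)) : EuclideanSpace ℝ (Fin 2) :=
  !₂[k4Val p.1, k4Val p.2]

/-- `k4Val` of a difference is the difference of the values. -/
theorem k4Val_sub (x y : ℤ × ℤ × ℤ × ℤ) : k4Val x - k4Val y = k4Val (bqSub x y) := by
  simp only [k4Val, bqSub]; push_cast; ring

/-- The square of `a + b√3 + cρ + d√3ρ` expanded on the basis `1, √3, ρ, √3ρ` (using `(√3)² = 3`, `ρ² = 5 − 2√3`). -/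
theorem k4Num_sq (x : ℤ × ℤ × ℤ × ℤ) :
    ((x.1 : ℝ) + (x.2.1 : ℝ) * Real.sqrt 3 + (x.2.2.1 : ℝ) * rhoK4 + (x.2.2.2 : ℝ) * (Real.sqrt 3 * rhoK4)) ^ 2 =
      (k4Norm0 x : ℝ) + (k4Norm3 x : ℝ) * Real.sqrt 3 + (k4NormR x : ℝ) * rhoK4 + (k4Norm3R x : ℝ) * (Real.sqrt 3 * rhoK4) := by
  have s3 : Real.sqrt 3 ^ 2 = 3 := Real.sq_sqrt (by norm_num)
  have sr : rhoK4 ^ 2 = 5 - 2 * Real.sqrt 3 := rhoK4_sq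
  simp only [k4Norm0, k4Norm3, k4NormR, k4Norm3R]; push_cast
  linear_combination ((x.2.1 : ℝ) ^ 2 + (x.2.2.2 : ℝ) ^ 2 * rhoK4 ^ 2 + 2 * (x.2.1 : ℝ) * (x.2.2.2 : ℝ) * rhoK4 -
      4 * (x.2.2.1 : ℝ) * (x.2.2.2 : ℝ)) * s3 +
    ((x.2.2.1 : ℝ) ^ 2 + 3 * (x.2.2.2 : ℝ) ^ 2 + 2 * (x.2.2.1 : ℝ) * (x.2.2.2 : ℝ) * Real.sqrt 3) * sr

/-- The square of `k4Val x` on the same basis (denominator `144`). -/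
theorem k4Val_sq (x : ℤ × ℤ × ℤ × ℤ) : k4Val x ^ 2 =
    ((k4Norm0 x : ℝ) + (k4Norm3 x : ℝ) * Real.sqrt 3 + (k4NormR x : ℝ) * rhoK4 + (k4Norm3R x : ℝ) * (Real.sqrt 3 * rhoK4)) / 144 := by
  rw [k4Val, div_pow, k4Num_sq]; norm_num

/-- The integer unit test gives `(Δx)² + (Δy)² = 1`. -/
theorem k4Val_sq_add_sq_eq_one {p q : (ℤ × ℤ × ℤ × ℤ) × (ℤ × ℤ × ℤ × ℤ)} (h : unitStepK4 p q = true) :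
    (k4Val q.1 - k4Val p.1) ^ 2 + (k4Val q.2 - k4Val p.2) ^ 2 = 1 := by
  simp only [unitStepK4, Bool.and_eq_true, beq_iff_eq] at h
  obtain ⟨⟨⟨h0, h3⟩, hR⟩, h3R⟩ := h
  have h0' : (k4Norm0 (bqSub q.1 p.1) : ℝ) + (k4Norm0 (bqSub q.2 p.2) : ℝ) = 144 := by exact_mod_cast h0
  have h3' : (k4Norm3 (bqSub q.1 p.1) : ℝ) + (k4Norm3 (bqSub q.2 p.2) : ℝ) = 0 := by exact_mod_cast h3
  have hR' : (k4NormR (bqSub q.1 p.1) : ℝ) + (k4NormR (bqSub q.2 p.2) : ℝ) = 0 := by exact_mod_cast hR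
  have h3R' : (k4Norm3R (bqSub q.1 p.1) : ℝ) + (k4Norm3R (bqSub q.2 p.2) : ℝ) = 0 := by exact_mod_cast h3R
  rw [k4Val_sub, k4Val_sub, k4Val_sq, k4Val_sq]
  linear_combination (h0' + Real.sqrt 3 * h3' + rhoK4 * hR' + (Real.sqrt 3 * rhoK4) * h3R') / 144

/-- The integer unit test implies unit distance. -/
theorem dist_ptK4_eq_one {p q : (ℤ × ℤ × ℤ × ℤ) × (ℤ × ℤ × ℤ × ℤ)} (h : unitStepK4 p q = true) :
    dist (ptK4 p) (ptK4 q) = 1 := by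
  have aux := k4Val_sq_add_sq_eq_one h
  have aux' : (k4Val p.1 - k4Val q.1) ^ 2 + (k4Val p.2 - k4Val q.2) ^ 2 = 1 := by linear_combination aux
  have hd : dist (ptK4 p) (ptK4 q) ^ 2 = 1 := by
    rw [EuclideanSpace.dist_sq_eq, Fin.sum_univ_two, Real.dist_eq, Real.dist_eq, sq_abs, sq_abs]
    simp [ptK4]
    linear_combination aux'
  exact (pow_eq_one_iff_of_nonneg dist_nonneg two_ne_zero).1 hd

/-- Every value `k4Val x` lies in any subfield of `ℝ` containing `√3` and `ρ`. -/
theorem k4Val_mem (K : IntermediateField ℚ ℝ) (h3 : Real.sqrt 3 ∈ K) (hr : rhoK4 ∈ K) (x : ℤ × ℤ × ℤ × ℤ) : k4Val x ∈ K := by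
  unfold k4Val
  refine div_mem ?_ (ofNat_mem _ 12)
  exact add_mem (add_mem (add_mem (intCast_mem _ _) (mul_mem (intCast_mem _ _) h3)) (mul_mem (intCast_mem _ _) hr))
    (mul_mem (intCast_mem _ _) (mul_mem h3 hr))

/-- Every point `ptK4 p` lies in `K²` for such `K`. -/
theorem ptK4_mem (K : IntermediateField ℚ ℝ) (h3 : Real.sqrt 3 ∈ K) (hr : rhoK4 ∈ K) (p : (ℤ × ℤ × ℤ × ℤ) × (ℤ × ℤ × ℤ × ℤ)) :
    ptK4 p ∈ fieldPoints K := by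
  intro i
  fin_cases i
  · exact k4Val_mem K h3 hr p.1
  · exact k4Val_mem K h3 hr p.2

/-- The realisation homomorphism `R₁₀ →g Γ(K²)` for every real field `K ∋ √3, ρ`. -/
def r10Hom (K : IntermediateField ℚ ℝ) (h3 : Real.sqrt 3 ∈ K) (hr : rhoK4 ∈ K) :
    r10Graph →g planeUnitDistanceGraph.induce (fieldPoints K) where
  toFun v := ⟨ptK4 (r10c v), ptK4_mem K h3 hr _⟩
  map_rel' h := dist_ptK4_eq_one h

/-- `χ(K²) ≥ 4` FOR EVERY REAL FIELD `K ∋ √3, √(5 − 2√3)` — in particular for the quartic field `ℚ(√3, √(5−2√3)) ⊂ ℚ₁₁` (first non-multiquadratic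
row; `χ(ℚ(√3)²) = 3`). -/
theorem not_colorable_three_plane_of_sqrt3_rho_mem (K : IntermediateField ℚ ℝ) (h3 : Real.sqrt 3 ∈ K) (hr : rhoK4 ∈ K) :
    ¬ (planeUnitDistanceGraph.induce (fieldPoints K)).Colorable 3 :=
  fun h => not_colorable_three_r10Graph (h.of_hom (r10Hom K h3 hr))

/-- The quartic field `ℚ(√3, √(5 − 2√3))` as a subfield of `ℝ`. -/
def quarticFieldK4 : IntermediateField ℚ ℝ := IntermediateField.adjoin ℚ {Real.sqrt 3, rhoK4}

/-- `4 ≤ χ(ℚ(√3, √(5−2√3))²)`. -/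
theorem four_le_chromaticNumber_plane_quarticFieldK4 :
    4 ≤ (planeUnitDistanceGraph.induce (fieldPoints quarticFieldK4)).chromaticNumber := by
  have h3 : Real.sqrt 3 ∈ quarticFieldK4 := IntermediateField.subset_adjoin ℚ _ (by simp)
  have hr : rhoK4 ∈ quarticFieldK4 := IntermediateField.subset_adjoin ℚ _ (by simp)
  by_contra hlt
  have hlt' : (planeUnitDistanceGraph.induce (fieldPoints quarticFieldK4)).chromaticNumber < (3 : ℕ∞) + 1 := lt_of_not_ge hlt
  have hle : (planeUnitDistanceGraph.induce (fieldPoints quarticFieldK4)).chromaticNumber ≤ (3 : ℕ) := Order.le_of_lt_add_one hlt'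
  exact not_colorable_three_plane_of_sqrt3_rho_mem _ h3 hr (chromaticNumber_le_iff_colorable.mp hle)

end Summit.Ventures.DiscreteObjects.UnitDistance
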